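import Literature.MathematicalPhysics.QuantumFieldTheory.Balaban1983to89.Node00.Record7
import Literature.MathematicalPhysics.QuantumFieldTheory.Balaban1983to89.B15LeafKnitExp

/-!
# `Balaban1983to89.B15LeafKnitRecord7` — YM-DAG node N12 · [Balaban1989LargeFieldI] CMP **122** (1989) 175–202 AT NODE 00's STAGE-7 RECORD
# (`Node00.IsRecordOfRecord₇C`): the junction of the N12 knit with definer ₇'s objects of record BY NAME, the VACUITY CENSUS of the B15 slot at
# Stage 7 in kernel form (the bundle `W` is still residual there), the satisfiable PINNED form of the slot, and the N12 HOOKS for the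
# W-pinning refinement of the record (Stage ₇b ∕ ₉: «`W P` built from `R`»)

statement-level bookkeeping over published theorems with citation tags; kernel-checked compositions of tree theorems;
nothing here is a claim about the Yang–Mills mass gap.

CITATION HEADER (lean-in-tree rule).  Source: T. Bałaban, *Large field renormalization. I. The basic step of the 𝐑 operation*, Commun. Math.
Phys. **122**, 175–202 (1989) [Balaban1989LargeFieldI] (cell paper B15 = «[IV]»): the representation (0.2), the operation (0.3) and its
normalisation (0.4) p. 176, Proposition 1 (1.78) p. 194, (1.80) p. 195, (1.89) p. 198, (1.99)–(1.102) pp. 200–201; with [Balaban1989LargeFieldII]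
(Thm 1 p. 355: the record predicate's dictionary) and [Balaban1988Convergent] ((0.2) p. 244: the density tower).  Seat `pub-ymgap-dag-n12-a` (YM-PLAN
Track A, HUMAN RULING D-0062: the KNIT-BY-NAME seat of node N12), module 7 of the seat (g2).  BY NAME and UNCHANGED: `…Node00.Record7` (seat node00-def:
`Stage7Params`, `Stage7Params.Admissible`, `residualOfStage7`, `Stage7Params.toStage5`, `IsRecordOfRecord₇C`, `densOfRecord₅_succ_stage7`),
`…Node00.Record5 ∕ Record5C` (`Stage5Params`, `densOfRecord₅`, `machineOfRecord₅`, `datumOfRecord₅`, `upOfRecord₅C`, `b5_main_of_isRecordOfRecord₅C`,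
`b7_main_of_isRecordOfRecord₅C`), `…Node00.ROperationOfRecord` (seat node00-def-R: `RepOfRecord`, `ROp03OfRecord`, `ROp03OfRecord_of_admissible`,
`TowerProvisos`), `…B15RopTotal` (seat dag-n12-b: `RepData`, `RepData.Provisos`, `RepData.rop`, `Admissible`), `…B15LeafKnit ∕ B15LeafKnitExp` (this seat,
modules 1–2: `knitRData`, `KnitData`, `knitW15`, `normalization04_knit`, `b15Leaf_knit_of`, `b15_main_of_up`, `KnitData.logExp`, `b15Leaf_knit_logExp_of`),
`…B15BasicStep` (b01: `RopReal`, `integral_ropReal_eq`), `…DagBinding` (`PrintedCarriers15`, `B15Leaf`, `leavesP`, `WorldP`).  §2 follows, decl by decl,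
the census pattern of seat dag-n13-a's `B16NodeKnitRecordPinned` §1 (itself adapted from referee dag-ref-D's probe F-n24T-1), for the B15 slot.

WHY THIS FILE.  NODE 00's Stage 7 (`Node00.Record7`, predicate of record `IsRecordOfRecord₇C`) overwrites the residual `χ ∕ dom ∕ E ∕ R` by definer ₇'s
objects: in particular the large-field operation of the record IS `ROp03OfRecord F N θ.rep` — [IV] (0.3) (b01's V-local `RopReal`, totalised by seat
dag-n12-b's `ropTotal`) read at the NEW residual `θ.rep : RepOfRecord`, the (0.2) representation-extraction datum (`B15RopTotal.RepData`: regions,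
`Z ↦ Z″`, fibre bonds of `Z′`, pieces).  The [IV] bundle `θ.res.W : B12.RunParams → PrintedCarriers15` that the binding's `rBasicStep` leaf reads is NOT
overwritten at Stage 7 (`res_W_toStage5`, `rfl`): it stays residual until the stage that BUILDS `W P` from `R` (seat node00-def `STAGE5-SCOPING-g28.md` §3
row `W P`: «₇ (W from R)»; `STAGE6-9-DESIGN-g28.md` §2: the represented tower, Stage ₉).  Consequently (§2, kernel facts): every UNIVERSAL form of N12's
slot over Stage 7 — «`B15Leaf (θ.res.W P)` for all admissible Stage-7 parameters», «… for the parameters of the datum», «`rBasicStep` at every run of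
every Stage-7 record world» — is UNSATISFIABLE (swap `W` for a bundle with an empty (1.89) claim; the datum, admissibility, `C`, `γ`, `L` do not
notice), exactly as dag-ref-D certified for N13's 𝐑-slot at Stage 5; the satisfiable form at ONE record is the PINNED one, and it is PRECISELY the
world's own leaf `∀ P, (w.up P).rBasicStep` (`forall_pinned_b15Leaf_iff_rBasicStep₇C`).  §1 records what the knit reads of definer ₇'s objects: the
knit's integration datum `knitRData` and definer ₇'s `RepData` carry the SAME four data, the knit's p. 176 provisos ARE `RepData.Provisos` (so definer
₇'s displayed clause `TowerProvisos θ.rep` is the knit's proviso input along the tower), the B15 leaf holds at the knit bundle READ AT any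
representation datum with the provisos (modulo the four displayed printed statements), and the binding's scalar (0.4) conjunct read at definer ₇'s
representation of the record's own `𝐓ρ_k` computes the integral of the record's `ρ_{k+1}` (the two readings of (0.3) — b2b's scalar `B15.Rop` and
b01's V-local `RopReal`, cell DIVERGENCE D-b01.1 — have equal integrals).  §3 gives N12 at one Stage-7 record in the pinned form, and the two HOOKS
for the W-pinning refinement: GENERIC over any parameter type whose worlds bind `upOfRecord₅C (toS5 θ)` (N12 at every record from the B15 leaf at
the stage's `W` of record — the shape `Node00.Carriers3.b6_main_of_isWorldOfRecord₃_of` had for N03), and in KNIT form (the stage pins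
`W P := knitW15 κ.logExp` at a knit record of its objects: N12 at every record from the p. 176 provisos and EXACTLY the displayed printed statements
Proposition 1 (1.78), (1.80) on the ℍ-domains of (1.89), (1.89), (1.102) — per module 4 `B15LeafKnit199` the last becomes a theorem at the
(1.99)-form pin).  §4: the in-edge leaves `b5`, `b7` hold at every Stage-7 record (N02 ∕ N04 of record) and are not consumed.

WHAT THIS FILE PROVES (0 `sorry`, 0 `def`, standard axioms).
§1 `res_W_toStage5` ∕ `res_R_toStage5` ∕ `rBasicStep_upOfRecord₅C_iff` ∕ `rBasicStep_iff_b15Leaf_res₇C` (what Stage 7 pins and what it leaves free, `rfl`);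
   `knitProvisos_iff_repDataProvisos` (the knit's provisos = `RepData.Provisos` of the datum with the same fields); **`b15Leaf_knit_logExp_at_repData`**
   (the leaf at the knit bundle read at ANY `d : RepData` with `d.Provisos` + numerators ≠ 0, modulo the four displays);
   `integral_rop_knit_eq_integral_ropReal` (scalar and V-local (0.3) have the same integral under the provisos); **`densOfRecord₇_succ_eq_rop`** ∕
   **`integral_rop_knit_eq_integral_densOfRecord₇_succ`** (at an admissible step of the record: `ρ_{k+1} = (θ.rep p k (𝐓ρ_k)).rop` and the binding's (0.4)
   left side read at that datum = `∫ρ_{k+1}`).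
§2 Census: `toStage5_updW`, `densOfRecord₅_updW`, `machineOfRecord₅_updW`, `datumOfRecord₅_updW`, **`datumOfRecord₇_updW`**, `admissible₇_updW`,
   `not_b15Leaf_emptyClaim`, **`not_forall_admissible_b15Leaf₇`**, **`not_forall_atDatum_b15Leaf₇C`**, `isRecordOfRecord₇C_updW`,
   **`not_forall_record_rBasicStep₇C`**, **`forall_pinned_b15Leaf_iff_rBasicStep₇C`**.
§3 `b15_main_of_isRecordOfRecord₇C_pinned` (N12 at one record, pinned form = the world's leaf); `b15_main_of_isRecordOfRecord₇C_of_leaf` (universal-slot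
   form — correct, premise unsatisfiable at ₇ by §2, dischargeable over the W-pinning refinement); **`b15_main_of_refines₅C_of_leaf`** (GENERIC HOOK);
   **`b15Leaf_of_pin_knit_logExp`** ∕ **`b15_main_of_refines₅C_knit_logExp`** (KNIT HOOK: N12 of record modulo provisos + the four displays, for any
   refinement pinning `W := knitW15 κ.logExp`).
§4 `b5_b7_at_record₇C` (in-edge leaves N02 ∕ N04 hold at every ₇C record, by name; not consumed); `b15_main_iff_rBasicStep_of_inEdges` (at a run whose
   five in-edge leaves hold, N12 ↔ its own leaf — no strength through the antecedents).

LOCATED TYPING OBSERVATION (for seat node00-def's W-pin, not a claim about print): `PrintedCarriers15` reads [IV] at ONE lattice level `W.j15` per run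
(`D`, `Rprime`, `ρk` are single-level objects), while print performs the basic step at every `k ≤ K`; a pin «W from R» is therefore a k-indexed family
`κ θ P k` of knit records of which the binding consumes one member per run (or Σ-over-k carriers for the `p1 ∕ i180 ∕ c189` conjuncts) — the hooks of
§3 are stated per bundle and serve either choice.

HONEST FRAMING.  A count-neutral landing (R429 (4)(i)): bookkeeping + census + hooks; N12 is NOT discharged — at Stage 7 its slot is the world's own leaf
as a HYPOTHESIS (dischargeable only once `W` is pinned, Stage ₇b ∕ ₉, and then modulo the printed estimates Proposition 1 (1.78), (1.80), (1.89) at the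
objects of record, each a located display with a tree mechanism: seat dag-n12-b's `B15Prop1FromModel.prop1Printed_of_model`, `B15Ineq180Lattice.ineq180_lattice`
via module 3 `B15LeafKnitGlue.h180_of_lattice`, p29's `B15Claim189Assembly.claim189_assembly_of_flow`); nothing of Bałaban's asserted or proved here; one finite
four-torus programme at fixed `ε`, Bałaban AS PRINTED with locators; nothing continuum ∕ ℝ⁴ ∕ OS ∕ mass gap ∕ Clay.
-/

noncomputable section

open scoped BigOperators
open MeasureTheory

namespace Literature.MathematicalPhysics.QuantumFieldTheory.Balaban1983to89.B15LeafKnitRecord7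

open DagBinding T4DatumAssembly T4Continuum Node00 FlowStepRuns
open B15 (RData Rop Normalization04 Prop1Printed Ineq180)
open B15.BasicStep (fibreIntegral RopReal Claim189 integral_ropReal_eq)
open B15Eq06Resum (quotSum)
open B15Sect1Statements (RPrimeData Normalization1102)
open B15Claim189Assembly (Setting189 new189 chiPP dom)
open B8Eq17ClassAkV1 (plaqsOf)
open B15RopTotal (RepData ropTotal_of_admissible)
open B15LeafKnit (knitRData KnitData knitW15 normalization04_knit b15Leaf_knit_of b15_main_of_up b15Leaf_of_b15_main)
open B15LeafKnitExp (b15Leaf_knit_logExp_of)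

variable {F : T4Family} {N : ℕ} [NeZero N]

/-! ## §1. What Stage 7 pins and what it leaves free; the knit read at definer ₇'s representation datum -/

section Junction

/-- **At Stage 7 the [IV] bundle is NOT overwritten**: the Stage-5 view of Stage-7 parameters has `res.W = θ.res.W` (`residualOfStage7` replaces
`χ ∕ dom ∕ E ∕ R` only; `rfl`). [cite: Balaban1989LargeFieldI, (0.2)–(0.4) p.176 (the objects substituted at Stage 7; bookkeeping)] -/
theorem res_W_toStage5 (θ : Stage7Params F N) : (θ.toStage5 F N).res.W = θ.res.W := rfl

/-- … whereas the large-field operation of the record IS definer ₇'s `ROp03OfRecord F N θ.rep` — [IV] (0.3) totalised, read at the residual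
representation-extraction datum `θ.rep` (`rfl`). [cite: Balaban1989LargeFieldI, (0.3) p.176] -/
theorem res_R_toStage5 (θ : Stage7Params F N) : (θ.toStage5 F N).res.R = ROp03OfRecord F N θ.rep := rfl

/-- The `rBasicStep` leaf of the C-binding of record at Stage-5 parameters IS `B15Leaf (θ.res.W P)` (`Iff.rfl`: the C-binding touches `b10` only,
`Record5C.upOfRecord₅C_leaves`; the N-binding's leaf is `DagDischargedII.ofPrintedAllXPN_leaves`). [cite: Balaban1989LargeFieldI, Prop. 1 p.194 (the leaf bound at the record; bookkeeping)] -/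
theorem rBasicStep_upOfRecord₅C_iff (θ : Stage5Params F N) (P : B12.RunParams) :
    (upOfRecord₅C F N θ P).rBasicStep ↔ B15Leaf (θ.res.W P) := Iff.rfl

/-- At a world bound by the C-binding of record at Stage-7 parameters, the `rBasicStep` leaf at run `P` IS the B15 leaf of the (residual) bundle
`θ.res.W P`. [cite: Balaban1989LargeFieldI, Prop. 1 p.194 (bookkeeping)] -/
theorem rBasicStep_iff_b15Leaf_res₇C (θ : Stage7Params F N) (w : WorldP) (P : B12.RunParams)
    (hup : w.up P = upOfRecord₅C F N (θ.toStage5 F N) P) : (w.up P).rBasicStep ↔ B15Leaf (θ.res.W P) := by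
  rw [hup]
  exact Iff.rfl

variable {P : Params} {j : ℕ} {G : Type} [GaugeGroup G] [MeasurableSpace G] [HaarData G]

/-- **The knit's p. 176 provisos ARE `RepData.Provisos`** of definer ₇'s ∕ dag-n12-b's representation datum with the same four data (regions, `Z ↦ Z″`,
fibre bonds, pieces) — verbatim the same conjunction (`Iff.rfl`); so definer ₇'s displayed clause `TowerProvisos θ.rep` is exactly the proviso input of
`B15LeafKnit.normalization04_knit` ∕ `b15Leaf_knit_of` along the tower. [cite: Balaban1989LargeFieldI, (0.3) p.176 («the densities are positive, … the denominators are positive»)] -/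
theorem knitProvisos_iff_repDataProvisos [DecidableEq (PBond P j)] (d : RepData P j G) :
    d.Provisos ↔
      (∀ Z, Measurable (d.piece Z)) ∧ (∀ Z V, 0 ≤ d.piece Z V) ∧ (∃ C : ℝ, ∀ Z V, d.piece Z V ≤ C) ∧
        ∀ Z V, fibreIntegral (d.fib Z) (d.piece (d.pp Z)) V ≠ 0 := Iff.rfl

/-- **THE B15 LEAF AT THE KNIT BUNDLE READ AT A REPRESENTATION DATUM** — for ANY `d : B15RopTotal.RepData P j G` (definer ₇'s residual `θ.rep p k ρ` is
one) with the p. 176 provisos `d.Provisos` and numerator fibre integrals nowhere zero: the knit record `⟨d.piece, d.pp, d.fib, ·⟩` with the (0.5)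
exponents pinned to `log` of the (0.5)-sums (module 2 `KnitData.logExp`) carries the leaf modulo EXACTLY the four displayed printed statements —
Proposition 1 (1.78) on the carrier `LF`, (1.80) on the ℍ-domains of the (1.89) letters `D189`, (1.89), (1.102) for the (1.100) data `D1100` at `ρk`
((0.4) and (0.6) PROVED: `normalization04_knit`, `hyp05Image_logExp`). [cite: Balaban1989LargeFieldI, (0.2)–(0.6) p.176, Prop. 1 (1.78) p.194, (1.80) p.195, (1.89) p.198, (1.102) p.201] -/
theorem b15Leaf_knit_logExp_at_repData [DecidableEq (PBond P j)] (d : RepData P j G) (hprov : d.Provisos)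
    (hnum : ∀ Z V, fibreIntegral (d.fib Z) (d.piece Z) V ≠ 0) {P₀ : Params} {C ι : Type}
    (LF : B15.LFVar) (D189 : Setting189 P₀ G C ι) (D1100 : RPrimeData P j G) (ρk : Density P j G)
    (hP1 : Prop1Printed LF)
    (h180 : ∀ U, new189 D189 U → ∀ i, D189.h ≤ i → i ≤ D189.k → ∀ p ∈ plaqsOf (dom D189 i),
      Ineq180 (D189.dev0 U p) (D189.ε D189.k) D189.η D189.B₃ D189.B₅ D189.M D189.δ (D189.dist p) D189.O1)
    (h189 : Claim189 (new189 D189) (chiPP D189)) (h1102 : Normalization1102 D1100 ρk) :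
    letI := d.fin
    letI := Classical.decEq d.Region
    B15Leaf (knitW15 (KnitData.logExp
      ({ piece := d.piece, pp := d.pp, fib := d.fib, Rexp := fun _ => 0, LF := LF, D189 := D189, D1100 := D1100, ρk := ρk } :
        KnitData P j G d.Region P₀ C ι))) := by
  letI := d.fin
  letI := Classical.decEq d.Region
  obtain ⟨hm, h0, ⟨Cρ, hC⟩, hden⟩ := hprov
  exact b15Leaf_knit_logExp_of _ hm h0 hC hnum hden hP1 h180 h189 h1102

/-- **The two readings of (0.3) have the same integral** under the p. 176 provisos: the binding's SCALAR operation `B15.Rop (knitRData piece pp fib)`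
(`∫dV⌈_{Z′}` := fibre integral averaged by `∫dV`, cell DIVERGENCE D-b01.1) and b01's V-LOCAL `RopReal piece pp fib` (definer ₇'s `RepData.rop`, the `R`
of record on its admissible branch) both integrate to `∫dV Σ_Z ρ(Z, V)` — `normalization04_knit` resp. `integral_ropReal_eq`; (0.4) is all either reading
asserts of the integral. [cite: Balaban1989LargeFieldI, (0.3)–(0.4) p.176] -/
theorem integral_rop_knit_eq_integral_ropReal [DecidableEq (PBond P j)] {R : Type} [Fintype R] (piece : R → Density P j G) (pp : R → R)
    (fib : R → Finset (PBond P j)) (hm : ∀ Z, Measurable (piece Z)) (h0 : ∀ Z V, 0 ≤ piece Z V) {Cρ : ℝ}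
    (hC : ∀ Z V, piece Z V ≤ Cρ) (hden : ∀ Z V, fibreIntegral (fib Z) (piece (pp Z)) V ≠ 0) :
    (∫ V, Rop (knitRData piece pp fib) V ∂(fieldMeasure P j G)) = ∫ V, RopReal piece pp fib V ∂(fieldMeasure P j G) := by
  have h04 : Normalization04 (knitRData piece pp fib) := normalization04_knit piece pp fib hm h0 hC hden
  have hV : (∫ V, RopReal piece pp fib V ∂(fieldMeasure P j G)) = ∫ V, ∑ Z, piece Z V ∂(fieldMeasure P j G) :=
    integral_ropReal_eq piece pp fib hm h0 hC hden
  rw [hV]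
  exact h04

variable (F N)

/-- **At an ADMISSIBLE step of a Stage-7 record the next density IS (0.3) of definer ₇'s representation of the record's own `𝐓ρ_k`**:
`ρ_{k+1} = R_k(𝐓ρ_k)` (`Record7.densOfRecord₅_succ_stage7`, `rfl`) and `R` of record is (0.3) on its admissible branch (`ROp03OfRecord_of_admissible`).
(Decidability of bond equality is the classical one, as in definer ₇'s `ROp03OfRecord` — stated inline so that the statement matches its lemmas verbatim.)
[cite: Balaban1989LargeFieldI, (0.2)–(0.3) p.176; Balaban1988Convergent, (0.2) p.244] -/
theorem densOfRecord₇_succ_eq_rop (θ : Stage7Params F N) (p : B12.RunParams) (k : ℕ)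
    (hadm : letI : DecidableEq (PBond (F.P p.K) (k + 1)) := fun a b => Classical.propDecidable (a = b)
      B15RopTotal.Admissible (θ.rep p k) (TrhoOfRecord F N p.K k (densOfRecord₅ F N (θ.toStage5 F N) p k))) :
    letI : DecidableEq (PBond (F.P p.K) (k + 1)) := fun a b => Classical.propDecidable (a = b)
    densOfRecord₅ F N (θ.toStage5 F N) p (k + 1) =
      (θ.rep p k (TrhoOfRecord F N p.K k (densOfRecord₅ F N (θ.toStage5 F N) p k))).rop := by
  rw [densOfRecord₅_succ_stage7]
  exact ROp03OfRecord_of_admissible F N hadm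

/-- **The binding's (0.4) left side, read at definer ₇'s representation of the record's own `𝐓ρ_k`, computes `∫dV ρ_{k+1}`** at an admissible step:
with `d := θ.rep p k (𝐓ρ_k)`, `∫dV 𝐑(knitRData d.piece d.pp d.fib) = ∫dV ρ_{k+1}` (the scalar reading of the leaf's datum and the V-local `R` of record
agree in the integral; `integral_rop_knit_eq_integral_ropReal` + `densOfRecord₇_succ_eq_rop`). [cite: Balaban1989LargeFieldI, (0.3)–(0.4) p.176; Balaban1988Convergent, (0.2) p.244] -/
theorem integral_rop_knit_eq_integral_densOfRecord₇_succ (θ : Stage7Params F N) (p : B12.RunParams) (k : ℕ)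
    (hadm : letI : DecidableEq (PBond (F.P p.K) (k + 1)) := fun a b => Classical.propDecidable (a = b)
      B15RopTotal.Admissible (θ.rep p k) (TrhoOfRecord F N p.K k (densOfRecord₅ F N (θ.toStage5 F N) p k))) :
    letI : DecidableEq (PBond (F.P p.K) (k + 1)) := fun a b => Classical.propDecidable (a = b)
    let d := θ.rep p k (TrhoOfRecord F N p.K k (densOfRecord₅ F N (θ.toStage5 F N) p k))
    letI := d.fin
    (∫ V, Rop (knitRData d.piece d.pp d.fib) V ∂(fieldMeasure (F.P p.K) (k + 1) (SU N))) =
      ∫ V, densOfRecord₅ F N (θ.toStage5 F N) p (k + 1) V ∂(fieldMeasure (F.P p.K) (k + 1) (SU N)) := by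
  letI : DecidableEq (PBond (F.P p.K) (k + 1)) := fun a b => Classical.propDecidable (a = b)
  intro d
  letI := d.fin
  rw [densOfRecord₇_succ_eq_rop F N θ p k hadm]
  obtain ⟨-, hm, h0, ⟨Cρ, hC⟩, hden⟩ := hadm
  exact integral_rop_knit_eq_integral_ropReal d.piece d.pp d.fib hm h0 hC hden

end Junction

/-! ## §2. Census: the Stage-7 datum and admissibility are blind to the residual [IV] bundle `θ.res.W` -/

section Census

/-- Swapping the residual [IV] bundle commutes with the Stage-5 view (`rfl`: `residualOfStage7` reads `βfun`, `rep`, `Efl`, `logz`, `ν`, never `W`).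
[cite: Balaban1989LargeFieldI, (0.2) p.176 (bookkeeping: the Stage-7 dictionary)] -/
theorem toStage5_updW (θ : Stage7Params F N) (W' : B12.RunParams → PrintedCarriers15) :
    ({ θ with res := { θ.res with W := W' } } : Stage7Params F N).toStage5 F N =
      { θ.toStage5 F N with res := { (θ.toStage5 F N).res with W := W' } } := rfl

/-- The Stage-5 density tower does not read `res.W` (induction on `k`; each step reads `res.E`, `res.R` only).  Twin of dag-n13-a's `densOfRecord₅_updV`.
[cite: Balaban1988Convergent, (0.2) p.244 (bookkeeping: the tower reads `E`, `R`)] -/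
theorem densOfRecord₅_updW (θ : Stage5Params F N) (W' : B12.RunParams → PrintedCarriers15) (p : B12.RunParams) :
    ∀ k, densOfRecord₅ F N { θ with res := { θ.res with W := W' } } p k = densOfRecord₅ F N θ p k
  | 0 => rfl
  | k + 1 => by
    show θ.res.R p k (TrhoOfRecord F N p.K k (densOfRecord₅ F N { θ with res := { θ.res with W := W' } } p k)) =
      θ.res.R p k (TrhoOfRecord F N p.K k (densOfRecord₅ F N θ p k))
    rw [densOfRecord₅_updW θ W' p k]

/-- Nor does the RG machine of the record. Twin of dag-n13-a's `machineOfRecord₅_updV`. [cite: Balaban1987RG1, (0.22)–(0.24) p.256 (bookkeeping: the machine's dictionary)] -/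
theorem machineOfRecord₅_updW (θ : Stage5Params F N) (W' : B12.RunParams → PrintedCarriers15) :
    machineOfRecord₅ F N { θ with res := { θ.res with W := W' } } = machineOfRecord₅ F N θ := by
  have hd : ∀ p k, densOfRecord₅ F N { θ with res := { θ.res with W := W' } } p k = densOfRecord₅ F N θ p k :=
    fun p k => densOfRecord₅_updW θ W' p k
  unfold machineOfRecord₅
  simp only [hd]

/-- **The Stage-5 DATUM is blind to the residual [IV] bundle**: `datumOfRecord₅ {θ with W := W'} = datumOfRecord₅ θ`.  Twin of dag-n13-a's ∕ dag-ref-D's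
`datumOfRecord₅_updV`. [cite: Balaban1988Convergent, (0.2) p.244 (bookkeeping: the [IV] leaf bundle is not an object of the datum)] -/
theorem datumOfRecord₅_updW (θ : Stage5Params F N) (W' : B12.RunParams → PrintedCarriers15) :
    datumOfRecord₅ F N { θ with res := { θ.res with W := W' } } = datumOfRecord₅ F N θ := by
  unfold datumOfRecord₅
  rw [machineOfRecord₅_updW]

/-- **The Stage-7 DATUM is blind to the residual [IV] bundle** (`toStage5_updW` + `datumOfRecord₅_updW`). [cite: Balaban1989LargeFieldI, (0.2) p.176; Balaban1988Convergent, (0.2) p.244 (bookkeeping)] -/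
theorem datumOfRecord₇_updW (θ : Stage7Params F N) (W' : B12.RunParams → PrintedCarriers15) :
    datumOfRecord₅ F N (({ θ with res := { θ.res with W := W' } } : Stage7Params F N).toStage5 F N) =
      datumOfRecord₅ F N (θ.toStage5 F N) := by
  rw [toStage5_updW, datumOfRecord₅_updW]

/-- Nor does Stage-7 admissibility read it (Stage-5 admissibility ∧ definer ₇'s numeric windows). [cite: Balaban1988Convergent, (2.4) p.255, (2.13)–(2.17) pp.256–257 (bookkeeping: the parameter dictionary)] -/
theorem admissible₇_updW {θ : Stage7Params F N} (hθ : θ.Admissible) (W' : B12.RunParams → PrintedCarriers15) :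
    ({ θ with res := { θ.res with W := W' } } : Stage7Params F N).Admissible :=
  hθ

/-- **A bundle failing the leaf**: on any bundle's data, configurations `Cfg := Unit` with `remaining :≡ ⊤` and `dropped :≡ ⊥` refute the (1.89) conjunct
`Claim189 remaining dropped` (= «remaining ⇒ dropped» pointwise), hence `B15Leaf`. [cite: Balaban1989LargeFieldI, (1.89) p.198 (as the leaf types it; bookkeeping)] -/
theorem not_b15Leaf_emptyClaim (W₀ : PrintedCarriers15) :
    ¬ B15Leaf { W₀ with Cfg := Unit, remaining := fun _ => True, dropped := fun _ => False } := fun h =>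
  h.c189 () trivial

/-- **Form (a) is unsatisfiable at Stage 7**: given ONE admissible Stage-7 parameter, «the B15 leaf holds for the residual [IV] bundle of EVERY admissible
Stage-7 parameter at every run» is FALSE (swap the bundle for the empty-claim one; admissibility does not notice).  Census of the `hleaf` premise of §3's
`b15_main_of_isRecordOfRecord₇C_of_leaf`: a correct implication whose hypothesis is undischargeable before `W` is pinned.
[cite: Balaban1989LargeFieldI, Prop. 1 p.194 (bookkeeping: the bundle is residual at Stage 7)] -/
theorem not_forall_admissible_b15Leaf₇ (θ₀ : Stage7Params F N) (h₀ : θ₀.Admissible) :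
    ¬ ∀ θ : Stage7Params F N, θ.Admissible → ∀ P : B12.RunParams, B15Leaf (θ.res.W P) := fun h =>
  not_b15Leaf_emptyClaim (θ₀.res.W ⟨0, F.m, 1⟩)
    (h { θ₀ with res := { θ₀.res with W := fun P =>
        { θ₀.res.W P with Cfg := Unit, remaining := fun _ => True, dropped := fun _ => False } } }
      (admissible₇_updW h₀ _) ⟨0, F.m, 1⟩)

variable {D : FiniteEpsData F (SU N)} {w : WorldP}

/-- **Form (b) is unsatisfiable at every `₇C` record**: the slot «for the parameters OF THE DATUM» `∀ θ, θ.Admissible → D = datumOfRecord₅ (θ.toStage5) → ∀ P,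
B15Leaf (θ.res.W P)` is FALSE whenever `(D, w)` is a Stage-7 record — the datum clause does not pin the bundle (`datumOfRecord₇_updW`).
[cite: Balaban1989LargeFieldI, Prop. 1 p.194; Balaban1989LargeFieldII, Thm 1 p.355 (bookkeeping: the record predicate)] -/
theorem not_forall_atDatum_b15Leaf₇C (h : IsRecordOfRecord₇C F N D w) :
    ¬ ∀ θ : Stage7Params F N, θ.Admissible → D = datumOfRecord₅ F N (θ.toStage5 F N) →
      ∀ P : B12.RunParams, B15Leaf (θ.res.W P) := by
  intro hW
  obtain ⟨θ, hθ, hD, -, -, -, -⟩ := h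
  refine not_b15Leaf_emptyClaim (θ.res.W ⟨0, F.m, 1⟩)
    (hW { θ with res := { θ.res with W := fun P =>
        { θ.res.W P with Cfg := Unit, remaining := fun _ => True, dropped := fun _ => False } } }
      (admissible₇_updW hθ _) ?_ ⟨0, F.m, 1⟩)
  rw [datumOfRecord₇_updW]
  exact hD

/-- Re-binding a `₇C` record's world to the bundle-swapped parameters is again a `₇C` record over the SAME datum (the datum, the construction, `γ`, `L` are
blind to `W`; the up-clause holds by construction). [cite: Balaban1989LargeFieldII, Thm 1 p.355 (bookkeeping: the record predicate)] -/
theorem isRecordOfRecord₇C_updW (h : IsRecordOfRecord₇C F N D w) :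
    ∃ θ : Stage7Params F N, θ.Admissible ∧ D = datumOfRecord₅ F N (θ.toStage5 F N) ∧
      (∀ P, w.up P = upOfRecord₅C F N (θ.toStage5 F N) P) ∧
      ∀ W' : B12.RunParams → PrintedCarriers15,
        IsRecordOfRecord₇C F N D
          { w with up := fun P => upOfRecord₅C F N (({ θ with res := { θ.res with W := W' } } : Stage7Params F N).toStage5 F N) P } := by
  obtain ⟨θ, hθ, hD, hC, hγ, hL, hup⟩ := h
  refine ⟨θ, hθ, hD, hup, fun W' => ⟨{ θ with res := { θ.res with W := W' } }, admissible₇_updW hθ W', ?_, hC, hγ, hL, fun _ => rfl⟩⟩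
  rw [datumOfRecord₇_updW]
  exact hD

/-- **Form (c) is unsatisfiable**: given ONE `₇C` record, «the [IV] leaf holds at every run of EVERY `₇C` record world» is FALSE (re-bind the record's world
to the empty-claim bundle: again a record, whose leaf fails).  N12's slot is satisfiable only over a record predicate that PINS `W` (Stage ₇b ∕ ₉).
[cite: Balaban1989LargeFieldI, Prop. 1 p.194; Balaban1989LargeFieldII, Thm 1 p.355 (bookkeeping: Stage-7 scoping of the [IV] slot)] -/
theorem not_forall_record_rBasicStep₇C (h : IsRecordOfRecord₇C F N D w) :
    ¬ ∀ (D' : FiniteEpsData F (SU N)) (w' : WorldP), IsRecordOfRecord₇C F N D' w' →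
      ∀ P : B12.RunParams, (w'.up P).rBasicStep := by
  intro hR
  obtain ⟨θ, -, -, -, hrec⟩ := isRecordOfRecord₇C_updW h
  exact not_b15Leaf_emptyClaim (θ.res.W ⟨0, F.m, 1⟩)
    (hR D _ (hrec fun P => { θ.res.W P with Cfg := Unit, remaining := fun _ => True, dropped := fun _ => False })
      ⟨0, F.m, 1⟩)

/-- **THE SATISFIABLE FORM** (dag-ref-D's repair shape `hR_pinned_iff`, for the [IV] slot): at a `₇C` record, the slot «for the parameters of the datum THAT
BIND THE WORLD» — `∀ θ, θ.Admissible → D = datumOfRecord₅ (θ.toStage5) → (∀ P, w.up P = upOfRecord₅C (θ.toStage5) P) → ∀ P, B15Leaf (θ.res.W P)` — is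
PRECISELY the world's own leaf `∀ P, (w.up P).rBasicStep` ([IV]'s block bound at the world's upstream block).
[cite: Balaban1989LargeFieldI, Prop. 1 p.194, (0.4)–(0.6) p.176, (1.80) p.195, (1.89) p.198, (1.102) p.201 (the leaf, bookkeeping)] -/
theorem forall_pinned_b15Leaf_iff_rBasicStep₇C (h : IsRecordOfRecord₇C F N D w) :
    (∀ θ : Stage7Params F N, θ.Admissible → D = datumOfRecord₅ F N (θ.toStage5 F N) →
        (∀ P, w.up P = upOfRecord₅C F N (θ.toStage5 F N) P) → ∀ P : B12.RunParams, B15Leaf (θ.res.W P)) ↔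
      ∀ P : B12.RunParams, (w.up P).rBasicStep := by
  refine ⟨fun hW P => ?_, fun hw θ' _ _ hup' P => (rBasicStep_iff_b15Leaf_res₇C θ' w P (hup' P)).1 (hw P)⟩
  obtain ⟨θ, hθ, hD, -, -, -, hup⟩ := h
  exact (rBasicStep_iff_b15Leaf_res₇C θ w P (hup P)).2 (hW θ hθ hD hup P)

end Census

/-! ## §3. N12 at one Stage-7 record (pinned form) and the hooks for the W-pinning refinement -/

section Hooks

variable {D : FiniteEpsData F (SU N)} {w : WorldP}

/-- **N12 AT ONE `₇C` RECORD, PINNED FORM**: `Dag.B15_main (leavesP w P)` from the [IV] leaf for the parameters of the datum that bind the world — i.e.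
(§2) from the world's own `rBasicStep` leaf; the antecedents `b5 b7 b8 b10 b11` are not used. [cite: Balaban1989LargeFieldI, Prop. 1 p.194 (bookkeeping)] -/
theorem b15_main_of_isRecordOfRecord₇C_pinned (h : IsRecordOfRecord₇C F N D w)
    (hW : ∀ θ : Stage7Params F N, θ.Admissible → D = datumOfRecord₅ F N (θ.toStage5 F N) →
      (∀ P, w.up P = upOfRecord₅C F N (θ.toStage5 F N) P) → ∀ P : B12.RunParams, B15Leaf (θ.res.W P))
    (P : B12.RunParams) : Dag.B15_main (leavesP w P) :=
  b15_main_of_up (U := w.up P) rfl ((forall_pinned_b15Leaf_iff_rBasicStep₇C h).1 hW P)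

/-- **N12 at every `₇C` record from the UNIVERSAL slot** «the B15 leaf at the residual bundle of every admissible Stage-7 parameter» — a correct
implication whose premise is UNSATISFIABLE at Stage 7 (`not_forall_admissible_b15Leaf₇`) and becomes dischargeable verbatim over the refinement that
pins `W` (there `θ.res.W` is a function of the record's objects). [cite: Balaban1989LargeFieldI, Prop. 1 p.194 (bookkeeping)] -/
theorem b15_main_of_isRecordOfRecord₇C_of_leaf
    (hleaf : ∀ θ : Stage7Params F N, θ.Admissible → ∀ P : B12.RunParams, B15Leaf (θ.res.W P))
    (h : IsRecordOfRecord₇C F N D w) (P : B12.RunParams) : Dag.B15_main (leavesP w P) := by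
  obtain ⟨θ, hθ, -, -, -, -, hup⟩ := h
  exact b15_main_of_up (hup P) ((rBasicStep_upOfRecord₅C_iff (θ.toStage5 F N) P).2 (hleaf θ hθ P))

/-- **GENERIC HOOK for the W-pinning refinement of the record.**  For ANY parameter type `Θ` with a Stage-5 view `toS5` and admissibility `Adm` whose
record worlds bind `w.up P = upOfRecord₅C (toS5 θ) P` (the shape of `IsRecordOfRecord₅C ∕ ₇C ∕ ₈C` and of every refinement `Record9…` keeping the
C-binding): if the B15 leaf holds at the stage's bundle of record `(toS5 θ).res.W P` for every admissible `θ`, then N12 holds at every run of every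
record world.  (The shape `Node00.Carriers3.b6_main_of_isWorldOfRecord₃_of` had for N03; instantiate `hleaf` with the stage's leaf theorem.)
[cite: Balaban1989LargeFieldI, Prop. 1 p.194, (0.4)–(0.6) p.176, (1.80) p.195, (1.89) p.198, (1.102) p.201 (the leaf at the objects of record; bookkeeping hook)] -/
theorem b15_main_of_refines₅C_of_leaf {Θ : Type*} (toS5 : Θ → Stage5Params F N) (Adm : Θ → Prop)
    (hleaf : ∀ θ, Adm θ → ∀ P : B12.RunParams, B15Leaf ((toS5 θ).res.W P))
    (hw : ∃ θ, Adm θ ∧ ∀ P, w.up P = upOfRecord₅C F N (toS5 θ) P) (P : B12.RunParams) : Dag.B15_main (leavesP w P) := by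
  obtain ⟨θ, hθ, hup⟩ := hw
  exact b15_main_of_up (hup P) ((rBasicStep_upOfRecord₅C_iff (toS5 θ) P).2 (hleaf θ hθ P))

variable {P : Params} {k : ℕ} {G : Type} [GaugeGroup G] [MeasurableSpace G] [HaarData G] [DecidableEq (PBond P k)]
variable {R : Type} [Fintype R] [DecidableEq R] {P₀ : Params} {C ι : Type}

/-- **The leaf at a bundle PINNED to a knit record with `log`-exponents**: if `W = knitW15 κ.logExp`, the leaf follows from the p. 176 provisos on `κ`'s
pieces (measurable, ≥ 0, bounded; numerator and denominator fibre integrals nowhere zero) and EXACTLY the four displayed printed statements Proposition 1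
(1.78), (1.80) on the ℍ-domains, (1.89), (1.102) (module 2 `b15Leaf_knit_logExp_of` transported along the pin). [cite: Balaban1989LargeFieldI, (0.4)–(0.6) p.176, Prop. 1 (1.78) p.194, (1.80) p.195, (1.89) p.198, (1.102) p.201] -/
theorem b15Leaf_of_pin_knit_logExp {W : PrintedCarriers15} (κ : KnitData P k G R P₀ C ι) (hpin : W = knitW15 κ.logExp)
    (hm : ∀ Z, Measurable (κ.piece Z)) (h0 : ∀ Z V, 0 ≤ κ.piece Z V) {Cρ : ℝ} (hC : ∀ Z V, κ.piece Z V ≤ Cρ)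
    (hnum : ∀ Z V, fibreIntegral (κ.fib Z) (κ.piece Z) V ≠ 0) (hden : ∀ Z V, fibreIntegral (κ.fib Z) (κ.piece (κ.pp Z)) V ≠ 0)
    (hP1 : Prop1Printed κ.LF)
    (h180 : ∀ U, new189 κ.D189 U → ∀ i, κ.D189.h ≤ i → i ≤ κ.D189.k → ∀ p ∈ plaqsOf (dom κ.D189 i),
      Ineq180 (κ.D189.dev0 U p) (κ.D189.ε κ.D189.k) κ.D189.η κ.D189.B₃ κ.D189.B₅ κ.D189.M κ.D189.δ (κ.D189.dist p) κ.D189.O1)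
    (h189 : Claim189 (new189 κ.D189) (chiPP κ.D189)) (h1102 : Normalization1102 κ.D1100 κ.ρk) : B15Leaf W := by
  rw [hpin]
  exact b15Leaf_knit_logExp_of κ hm h0 hC hnum hden hP1 h180 h189 h1102

/-- **KNIT HOOK — N12 OF RECORD over any refinement pinning `W P := knitW15 (κ θ P).logExp`**: for a parameter type `Θ` as in
`b15_main_of_refines₅C_of_leaf` whose Stage-5 view PINS the [IV] bundle of every run to the knit bundle of a knit record `κ θ P` of its objects (the
(0.2) pieces ∕ regions ∕ fibre bonds of the step's represented density, the Proposition-1 carrier, the (1.89) letters, the (1.100) data, `ρ_k`), N12 holds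
at every run of every record world from: the p. 176 provisos at every `(θ, P)` and the four displayed printed statements at the objects of record —
Proposition 1 (1.78), (1.80) on the ℍ-domains, (1.89), (1.102).  THIS is the discharge shape of N12 modulo the W-pin (a definition act of NODE 00) and the
printed estimates of [IV]. [cite: Balaban1989LargeFieldI, Prop. 1 (1.78) p.194, (0.2)–(0.6) p.176, (1.80) p.195, (1.89) p.198, (1.102) p.201] -/
theorem b15_main_of_refines₅C_knit_logExp {Θ : Type*} (toS5 : Θ → Stage5Params F N) (Adm : Θ → Prop)
    (κ : Θ → B12.RunParams → KnitData P k G R P₀ C ι)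
    (hpin : ∀ θ, Adm θ → ∀ Pr : B12.RunParams, (toS5 θ).res.W Pr = knitW15 (κ θ Pr).logExp)
    (hprov : ∀ θ, Adm θ → ∀ Pr : B12.RunParams,
      (∀ Z, Measurable ((κ θ Pr).piece Z)) ∧ (∀ Z V, 0 ≤ (κ θ Pr).piece Z V) ∧ (∃ Cρ : ℝ, ∀ Z V, (κ θ Pr).piece Z V ≤ Cρ) ∧
      (∀ Z V, fibreIntegral ((κ θ Pr).fib Z) ((κ θ Pr).piece Z) V ≠ 0) ∧
      (∀ Z V, fibreIntegral ((κ θ Pr).fib Z) ((κ θ Pr).piece ((κ θ Pr).pp Z)) V ≠ 0))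
    (hP1 : ∀ θ, Adm θ → ∀ Pr : B12.RunParams, Prop1Printed (κ θ Pr).LF)
    (h180 : ∀ θ, Adm θ → ∀ Pr : B12.RunParams, ∀ U, new189 (κ θ Pr).D189 U → ∀ i, (κ θ Pr).D189.h ≤ i → i ≤ (κ θ Pr).D189.k →
      ∀ p ∈ plaqsOf (dom (κ θ Pr).D189 i),
      Ineq180 ((κ θ Pr).D189.dev0 U p) ((κ θ Pr).D189.ε (κ θ Pr).D189.k) (κ θ Pr).D189.η (κ θ Pr).D189.B₃ (κ θ Pr).D189.B₅
        (κ θ Pr).D189.M (κ θ Pr).D189.δ ((κ θ Pr).D189.dist p) (κ θ Pr).D189.O1)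
    (h189 : ∀ θ, Adm θ → ∀ Pr : B12.RunParams, Claim189 (new189 (κ θ Pr).D189) (chiPP (κ θ Pr).D189))
    (h1102 : ∀ θ, Adm θ → ∀ Pr : B12.RunParams, Normalization1102 (κ θ Pr).D1100 (κ θ Pr).ρk)
    (hw : ∃ θ, Adm θ ∧ ∀ Pr, w.up Pr = upOfRecord₅C F N (toS5 θ) Pr) (Pr : B12.RunParams) : Dag.B15_main (leavesP w Pr) := by
  refine b15_main_of_refines₅C_of_leaf toS5 Adm (fun θ hθ Pr => ?_) hw Pr
  obtain ⟨hm, h0, ⟨Cρ, hC⟩, hnum, hden⟩ := hprov θ hθ Pr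
  exact b15Leaf_of_pin_knit_logExp (κ θ Pr) (hpin θ hθ Pr) hm h0 hC hnum hden (hP1 θ hθ Pr) (h180 θ hθ Pr) (h189 θ hθ Pr)
    (h1102 θ hθ Pr)

end Hooks

/-! ## §4. The in-edges at a Stage-7 record (vacuity guard) -/

section InEdges

variable {D : FiniteEpsData F (SU N)} {w : WorldP}

/-- **The in-edge nodes N02 · [Balaban1984PropagatorsI] and N04 · [Balaban1985Averaging] HOLD at every run of every `₇C` record** (NODE 00's theorems of
record through the refinement `₇C → ₅C`, by name) — they are not consumed by the N12 hooks. [cite: Balaban1984PropagatorsI, Props. 1.1–1.2 pp.33–36; Balaban1985Averaging, Props. 1–10 pp.26–50 (kernel versions of the lineages at the objects of record)] -/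
theorem b5_b7_at_record₇C (h : IsRecordOfRecord₇C F N D w) (P : B12.RunParams) :
    Dag.B5_main (leavesP w P) ∧ Dag.B7_main (leavesP w P) :=
  ⟨b5_main_of_isRecordOfRecord₅C (isRecordOfRecord₅C_of_isRecordOfRecord₇C h) P,
    b7_main_of_isRecordOfRecord₅C (isRecordOfRecord₅C_of_isRecordOfRecord₇C h) P⟩

/-- **At a run whose five in-edge leaves are inhabited, N12 IS its own leaf** (no strength is gained or lost through the antecedents `b5 b7 b8 b10 b11`):
`Dag.B15_main (leavesP w P) ↔ (w.up P).rBasicStep`. [cite: Balaban1989LargeFieldI, Prop. 1 p.194 (the node of `Dag.lean`, bookkeeping)] -/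
theorem b15_main_iff_rBasicStep_of_inEdges (w : WorldP) (P : B12.RunParams) (h5 : (w.up P).b5) (h7 : (w.up P).b7)
    (h8 : (w.up P).b8) (h10 : (w.up P).b10) (h11 : (w.up P).b11) :
    Dag.B15_main (leavesP w P) ↔ (w.up P).rBasicStep :=
  ⟨fun h => (show (w.up P).b5 → (w.up P).b7 → (w.up P).b8 → (w.up P).b10 → (w.up P).b11 → (w.up P).rBasicStep from h)
      h5 h7 h8 h10 h11,
    fun h => b15_main_of_up (U := w.up P) rfl h⟩

end InEdges

end Literature.MathematicalPhysics.QuantumFieldTheory.Balaban1983to89.B15LeafKnitRecord7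

end
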